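import Mathlib
import Literature.Analysis.Calculus.JacobiFormula
import Literature.MathematicalPhysics.QuantumFieldTheory.Balaban1983to89.Beta.OneLoop
import Literature.MathematicalPhysics.QuantumFieldTheory.Balaban1983to89.Beta.FamilyRegularity
import Literature.MathematicalPhysics.QuantumFieldTheory.Balaban1983to89.Beta.KKTBridge

/-!
# `Balaban1983to89.Beta.LogDetHessian` — β sub-cell, kernel node BETA-an2-HESSIAN-KERNEL (row an2's hand-over (k2),
`BETA/AN2-pv09.md` §9): JACOBI'S SECOND-ORDER FORMULA for the one-loop polarization `Beta.polarization` of
`…Beta.OneLoop` — `Π_{ij} = −½[tr(K₀⁻¹∂ᵢ∂ⱼK) − tr(K₀⁻¹∂ᵢK K₀⁻¹∂ⱼK)]`, `K(B) = [[Δ(B), Q̃(B)ᵀ],[Q̃(B), 0]]` — the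
EXPLICIT BLOCK INVERSE `K₀⁻¹ = [[𝒢, ℋ],[ℋᵀ, −𝒮]]` under `Regular`, and the resulting MASTER FORMULA (M), kernel-checked

HONEST FRAMING (BETA-SPEC.md, verbatim): discharging `BetaPertH` makes Bałaban's UV stability UNCONDITIONAL — a real
constructive-QFT result; it is NOT the continuum limit and NOT the Clay problem.  THIS MODULE ASSERTS NOTHING about the
series and nothing about the sign or size of β: every declaration is a kernel-checked theorem of finite-dimensional
real calculus / linear algebra about the cell's OWN model objects `Beta.ConstrainedGaussian.{kkt, logZ, Regular}`,
`Beta.Family`, `Beta.polarization`, `Beta.hessianAt` (tree `Beta/OneLoop.lean`, unit pv25, v1.2 p177369), using BY NAME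
unit pv16's `Family.contDiffAt_det_kkt` (`Beta/FamilyRegularity.lean`, p177597 fb83c9f06691) and unit pv23's
`KKTBridge.{kkt_det_ne_zero, gram_posDef, constraintGram_posDef, reduced_posDef}` (`Beta/KKTBridge.lean`, p177581
0027a1617590), never restated.  No `def … : Prop`; the `def`s below are explicit continuous linear maps / matrices (entry
and trace functionals, the entrywise derivative matrices `∂Q̃, ∂Δ, ∂K, ∂²…`, and `𝒢`, `Q⁺`, `ℋ`, `ℋ♭`, `𝒮`, the candidate
block inverse), not statements.  Value = the kernel certificate of the AGREEMENT HOOK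
(M) that rows an1 · an2 · num of the β sub-cell consume (BETA-SPEC §8.3, AN2-pv09 §7) — i.e. of two lemmas (L3.2, L3.3)
that the programme-internal prose file `run/shared/lean/pub/pub-balaban/BETA/AN2-pv09.md` states WITHOUT proof; that
file is NOT cited as a source of facts here (cell rule: programme-internal claims are never citable) — its two lemmas
are PROVED below for the model.  NOT summit progress.

CITATION HEADER (lean-in-tree rule 2026-08-18; CONTEXT ONLY — nothing of the paper is restated as a fact; the quotations
are those already carried, verbatim, by `Beta/OneLoop.lean` and `Beta/FamilyRegularity.lean`, read there from the x2
page renders).  T. Bałaban, *Renormalization group approach to lattice gauge field theories. I. Generation of effective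
actions in a small field approximation and a coupling constant renormalization in four dimensions*, Commun. Math. Phys.
**109**, 249–301 (1987) [Balaban1987RG1] (cell paper B12; held `paper:balaban1987-cmp109-rg-i-small-field`; journal
page = PDF page + 248):
* p. 264 [PDF 16], the object: *"Let us denote E^{(j+1)}(g_j, B) = E^{(j+1)}(g_j, U_{j+1}(exp iB)). We define
  Π^{ab}_{j+1,μν}(g_j, x, x′) = (δ²/(δB^a_μ(x)δB^b_ν(x′)) E^{(j+1)})(g_j, 0). (1.20) This is the vacuum polarization
  tensor of the theory defined by the j-th fluctuation field integral."* — modelled (its ONE-LOOP part, OBJECTS.md O11) by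
  `Beta.polarization F i j := iteratedFDeriv ℝ 2 (Family.logZ F) 0 ![e_i, e_j]` along a background family
  `F : Family ι n m := (ι → ℝ) → ConstrainedGaussian n m`.
* p. 260 [PDF 12], the integrand: *"Z^{(j)}(U_k) = ∫ dB δ(Q̃B) exp\[−½⟨B, Δ^{(j)}(U_k)B⟩\]"* (1.4) — modelled by
  `ConstrainedGaussian.logZ Z := ((n − m)/2)·log 2π − ½·log |det [[Δ, Qᵀ],[Q, 0]]|` (bordered / KKT determinant).
The printed text differentiates `E^{(j+1)}` twice in the background without displaying the resulting trace formula; the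
formula below is the classical second-order Jacobi identity for `log det` applied to the MODEL.

PRIOR ART IN THE TREE (credited, not duplicated).  Both FIRST-ORDER rules of matrix calculus used here are already in
`Literature/Analysis/Calculus/`: Jacobi's formula in Fréchet form for a matrix FIELD `A : E → ι → ι → ℝ` (product norm)
— `Literature.Analysis.Calculus.hasFDerivAt_det`, `hasFDerivAt_det_apply_eq_det_mul_trace`, `fderiv_det_apply`
(`MatrixFieldDeriv.lean`, [cite: MagnusNeudecker2019, Ch. 8 Thm. 8.1]) — and the derivative of the inverse, ENTRYWISE,
`hasFDerivAt_inv_apply` / `fderiv_inv_apply` (`MatrixFieldDeriv.lean`, [cite: MagnusNeudecker2019, Ch. 8 §8.4]); the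
curve form `hasDerivAt_det_one_add_smul` / `hasDerivAt_det_eq_det_mul_trace` / `hasDerivAt_log_det` is in
`JacobiFormula.lean` (the first is used below BY NAME).  Part 1 RESTATES the two rules — it does not claim them — as
Fréchet derivatives of the maps `det`, `log ∘ det`, `(·)⁻¹` ON THE NORMED ALGEBRA `Matrix p p ℝ` itself (scoped `L^∞`
operator norm): `LogDetHessian.fderiv_det_apply`, `hasFDerivAt_log_det`, `hasFDerivAt_inv` carry the same
Magnus–Neudecker cite tags (J. R. Magnus, H. Neudecker, *Matrix Differential Calculus with Applications in Statistics
and Econometrics*, 3rd ed., Wiley 2019, Ch. 8, Thm. 8.1 and §8.4 [MagnusNeudecker2019]) and say so in their docstrings.  Why restated rather than imported: the second variation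
is obtained by composing continuous linear maps `Matrix →L Matrix` / `Matrix →L ℝ` (`HasFDerivAt.clm_comp`, chain rule
through `(·)⁻¹`), which needs `HasFDerivAt` of `Matrix.inv` as ONE matrix-valued map on one normed space, whereas the
tree's inverse rule is stated entry by entry for fields valued in `ι → ι → ℝ` with the product norm; under this file's
single-topology discipline (TECHNICAL NOTE) the type `Matrix p p ℝ` carries the operator-norm instances, and transporting
every use across `Matrix.of` and a norm-equivalence isomorphism would cost more than the short proofs (Mathlib's
`hasFDerivAt_ringInverse` gives the inverse rule in three lines once `Matrix p p ℝ` is a complete normed ring).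
GENUINELY NEW here (checked against `Analysis/Calculus/{JacobiFormula, MatrixFieldDeriv, MatrixFieldCLM, MatrixFieldSmooth,
BorderedSecondOrder}.lean` and `Beta/LogDetVariation.lean`): the SECOND variation `fderiv_fderiv_log_det[_entrywise]`
(with the glue `exists_local_fderiv`, `contDiffAt_matrix`, `fderiv[_fderiv]_apply_entry`), and all of Parts 2, 2b, 3.

WHAT IS PROVED (0 sorry; Mathlib + `Literature/Analysis/Calculus/JacobiFormula.lean` + the three Beta modules above):
(1) [restatements of the tree's first-order rules, see PRIOR ART] `LogDetHessian.hasFDerivAt_log_det` —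
    `D(log det)(A) = (H ↦ tr(A⁻¹H))` at a nonsingular `A` (operator-norm form of
    `Literature.Analysis.Calculus.hasFDerivAt_det_apply_eq_det_mul_trace`); `LogDetHessian.hasFDerivAt_inv` —
    `D(·⁻¹)(A) = (H ↦ −A⁻¹HA⁻¹)` as a `Matrix →L Matrix` derivative (matrix-valued form of
    `Literature.Analysis.Calculus.fderiv_inv_apply`; proof: Mathlib's `hasFDerivAt_ringInverse`).  Matrix calculus runs in
    the `L^∞` operator norm `Matrix.linftyOp*` (scoped `Matrix.Norms.Operator`; all norms on a finite-dimensional space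
    being equivalent, no exported `Family` statement mentions a norm).
(2) `LogDetHessian.fderiv_fderiv_log_det` — for `K : E → Matrix p p ℝ` of class `C²` at `x₀` with `det K(x₀) ≠ 0`:
    `D²(log det K)(x₀)[u,v] = tr(K₀⁻¹ D²K(x₀)[u,v]) − tr(K₀⁻¹ DK(x₀)[u] K₀⁻¹ DK(x₀)[v])`; and its norm-free ENTRYWISE
    form `fderiv_fderiv_log_det_entrywise` (hypothesis: every entry `C²`; derivative matrices formed entry by entry).
(3) `LogDetHessian.master_formula` — pure block algebra: for `W = [[G, H],[Hᵀ, −S]]` with `G`, `S` symmetric and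
    symmetric `Δ₁`, `Δ₂`:  `−½[tr(W·[[Δ₁₂,Q₁₂ᵀ],[Q₁₂,0]]) − tr(W[[Δ₁,Q₁ᵀ],[Q₁,0]]W[[Δ₂,Q₂ᵀ],[Q₂,0]])]
    = −½tr(GΔ₁₂) + ½tr(GΔ₁GΔ₂) − tr(HQ₁₂) + tr(HQ₁HQ₂) − tr(GQ₁ᵀSQ₂) + tr(GΔ₁HQ₂) + tr(GΔ₂HQ₁)` — the seven terms and
    signs of (M), AN2-pv09 L3.3, confirmed by the kernel (general, non-symmetric expansions:
    `trace_blockInv_mul_variation`, `trace_blockInv_mul_variation_sq`).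
(4) `LogDetHessian.proj_add_proj`, `kkt_mul_blockInv`, `kkt_inv_eq_fromBlocks` — AN2-pv09 L3.2 as a theorem: for
    `QC = 0` with `CᵀC`, `QQᵀ`, `CᵀΔC` nonsingular on complementary index types, `C(CᵀC)⁻¹Cᵀ + Qᵀ(QQᵀ)⁻¹Q = 1` and
    `[[Δ,Qᵀ],[Q,0]]⁻¹ = [[𝒢, ℋ],[ℋ♭, −𝒮]]`, `𝒢 = C(CᵀΔC)⁻¹Cᵀ`, `ℋ = (1 − 𝒢Δ)Q⁺`, `ℋ♭ = (QQᵀ)⁻¹Q(1 − Δ𝒢)` (`= ℋᵀ`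
    for symmetric `Δ`, `blockInv_symm`), `𝒮 = (QQᵀ)⁻¹Q(Δ − Δ𝒢Δ)Q⁺`, `Q⁺ = Qᵀ(QQᵀ)⁻¹` — by the direct check
    `K·W = 1` (no symmetry of `Δ` needed for that).
(5) `Family.polarization_eq_trace` — JACOBI FOR `Π`: if the entries of `Q̃(·)`, `Δ(·)` are `C²` at `0` and
    `det K(0) ≠ 0` then `polarization F i j = −½[tr(K₀⁻¹ ∂ᵢ∂ⱼK) − tr(K₀⁻¹ ∂ᵢK K₀⁻¹ ∂ⱼK)]` with the entrywise
    derivative matrices `Family.dK`, `Family.d2K` (`= [[∂Δ, ∂Q̃ᵀ],[∂Q̃, 0]]` blockwise, `dK_eq_fromBlocks`,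
    `d2K_eq_fromBlocks`); `…_of_regular`: `det K(0) ≠ 0` discharged by `(F 0).Regular` (pv23).
(6) `Family.polarization_master` — (M) for `Π` given any symmetric block form `K₀⁻¹ = [[G,H],[Hᵀ,−S]]` and `Δ(B)`
    symmetric near `0`; `Family.polarization_master_explicit` — (M) WITH THE PROPAGATORS OF (4) under `(F 0).Regular`,
    for any injective kernel parametrisation `C` of `ker Q̃(0)` with `r + m = n` (one exists: pv23's
    `KKTBridge.exists_kernelBasis`).  This is exactly the sentence of AN2-pv09 L3.3 "In pv25's Lean: `polarization F i j`
    = (M) whenever B ↦ (Q(B),Δ(B)) is C² near 0 and F 0 is `Regular`" — now a theorem (with "C² near 0" in the precise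
    form "entries `ContDiffAt ℝ 2` at 0", which is what `iteratedFDeriv` needs).

WHAT IS NOT HERE.  Nothing about Bałaban's actual operators (`H_{1,k}`, `Δ_1`, `Q̃(U_{k+1}(exp iB))`, the minimisers of
B11) is asserted; which concrete `Family` models (1.20) and that its data are `C²` (indeed analytic) in `B` on the
small-field region is for the rows that BUILD families (AN1 Table T, OBJECTS.md §5; GAPS G-an2-2 (T1)–(T3)); the
identification of `𝒢`, `ℋ`, `𝒮` with the printed propagators `C^{(k)}`, `H`-type minimisers and `(QG₁Q*)⁻¹`-type blocks
([Balaban1985BackgroundPropagators] (3.126), (3.156), (3.158)) is DIVERGENCE D-an2.1's dictionary, not a theorem; no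
manuscript step is adjudicated (GAPS row C-pv09g3-1 is a KERNEL certification of this file only).

TECHNICAL NOTE.  The global product topology / uniformity instances on `Matrix` and those induced by the scoped operator
norm are definitionally but not reducibly equal; `attribute [-instance] instTopologicalSpaceMatrix Matrix.instUniformSpace`
(local to this file) keeps every elaborated topology on the normed path so that `rw`/`simp` see one instance.  Exported
`Family` statements involve only scalar-valued functions on `ι → ℝ` and are unaffected.  NOTE FOR CONSUMERS: the Part 1
lemmas whose statements mention `Matrix p p ℝ` as a normed space (`hasFDerivAt_det`, `fderiv_det_apply`,
`hasFDerivAt_log_det`, `hasFDerivAt_inv`, `contDiffAt_matrix`, `hasFDerivAt_entry`, `fderiv[_fderiv]_apply_entry`,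
`fderiv_fderiv_log_det[_entrywise]` for `K : E → Matrix p p ℝ`) elaborate against the scoped `linftyOp` instances and
will NOT unify with the global product-topology instance in an importing file unless that file repeats
`open scoped Matrix.Norms.Operator` and the same `attribute [-instance] …` line; the `Family.*` theorems of Part 3
(`polarization_eq_trace[_of_regular]`, `polarization_master[_of_regular|_explicit]`, `dK`/`d2K` lemmas) need neither.
-/

noncomputable section

open Matrix Topology Filter
open scoped Matrix.Norms.Operator

/- The global product topology / uniformity on `Matrix` and the ones induced by the scoped operator norm are
definitionally equal but not reducibly so; to keep every elaborated `TopologicalSpace (Matrix _ _ ℝ)` on ONE path we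
erase the global instances for this file (the scoped normed instances supply them). -/
attribute [-instance] instTopologicalSpaceMatrix Matrix.instUniformSpace

namespace Literature.MathematicalPhysics.QuantumFieldTheory.Balaban1983to89.Beta

namespace LogDetHessian

/-! ## Part 1 — matrix calculus in the `L^∞` operator norm (any two norms on a finite-dimensional space agree
topologically; the norm is scoped to this file and appears in no exported statement about `Beta.Family`) -/

section MatrixCalculus

variable {p : Type*} [Fintype p] [DecidableEq p]

/-- The `(i, j)` entry as a continuous linear functional. [folklore] -/
def entryCLM (i j : p) : Matrix p p ℝ →L[ℝ] ℝ :=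
  LinearMap.toContinuousLinearMap (Matrix.entryLinearMap ℝ ℝ i j)

/-- `entryCLM i j M = M i j`. [folklore] -/
@[simp] theorem entryCLM_apply (i j : p) (M : Matrix p p ℝ) : entryCLM i j M = M i j := rfl

/-- The trace as a continuous linear functional. [folklore] -/
def trCLM : Matrix p p ℝ →L[ℝ] ℝ :=
  LinearMap.toContinuousLinearMap (Matrix.traceLinearMap p ℝ ℝ)

/-- `trCLM M = tr M`. [folklore] -/
@[simp] theorem trCLM_apply (M : Matrix p p ℝ) : trCLM M = M.trace := rfl

/-- `H ↦ tr (X H)`, the shape of the first variation of `log det` (`X = A⁻¹`). [folklore] -/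
def trMul (X : Matrix p p ℝ) : Matrix p p ℝ →L[ℝ] ℝ :=
  ContinuousLinearMap.compL ℝ (Matrix p p ℝ) (Matrix p p ℝ) ℝ trCLM (ContinuousLinearMap.mul ℝ (Matrix p p ℝ) X)

/-- `trMul X H = tr(XH)`. [folklore] -/
@[simp] theorem trMul_apply (X H : Matrix p p ℝ) : trMul X H = (X * H).trace := rfl

/-- The determinant is `C^k` for every `k` as a function on the matrix algebra (operator norm) — unit pv16's
`Beta.contDiffAt_matrix_det` (`Beta/FamilyRegularity.lean`, det of an entrywise-`C^k` matrix field) applied BY NAME to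
the identity field, whose entries are the continuous linear functionals `entryCLM i j`. [folklore] -/
theorem contDiff_det {k : WithTop ℕ∞} : ContDiff ℝ k (fun M : Matrix p p ℝ => M.det) :=
  contDiff_iff_contDiffAt.2 fun _ =>
    contDiffAt_matrix_det (M := fun M : Matrix p p ℝ => M) fun i j => (entryCLM i j).contDiff.contDiffAt

/-- Jacobi along a line: `d/dt det(A + tH)|_{t=0} = det A · tr(A⁻¹H)` for nonsingular `A`, from the tree's
`Literature.Analysis.Calculus.hasDerivAt_det_one_add_smul` (JacobiFormula.lean) by factoring out `A`. [folklore] -/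
theorem hasDerivAt_det_add_smul (A H : Matrix p p ℝ) (hA : IsUnit A.det) :
    HasDerivAt (fun t : ℝ => (A + t • H).det) (A.det * (A⁻¹ * H).trace) 0 := by
  have hfun : (fun t : ℝ => (A + t • H).det) = fun t => A.det * (1 + t • (A⁻¹ * H)).det := by
    funext t
    rw [← Matrix.det_mul, Matrix.mul_add, Matrix.mul_one, Matrix.mul_smul,
      Matrix.mul_nonsing_inv_cancel_left A H hA]
  rw [hfun]
  exact (Literature.Analysis.Calculus.hasDerivAt_det_one_add_smul (A⁻¹ * H)).const_mul A.det

/-- The determinant is Fréchet differentiable everywhere on the matrix algebra (operator norm); cf. the tree's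
`Literature.Analysis.Calculus.hasFDerivAt_det` for matrix fields. [folklore] -/
theorem hasFDerivAt_det (A : Matrix p p ℝ) :
    HasFDerivAt (fun M : Matrix p p ℝ => M.det) (fderiv ℝ (fun M : Matrix p p ℝ => M.det) A) A :=
  ((contDiff_det (k := 1)).contDiffAt.differentiableAt one_ne_zero).hasFDerivAt

/-- Jacobi's formula, Fréchet form ON THE MATRIX ALGEBRA: `D det(A)[H] = det A · tr(A⁻¹H)` for nonsingular `A`.
This is the operator-norm / `Matrix`-valued RESTATEMENT of the tree's
`Literature.Analysis.Calculus.hasFDerivAt_det_apply_eq_det_mul_trace` / `fderiv_det_apply` (`MatrixFieldDeriv.lean`,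
stated for fields `E → ι → ι → ℝ` in the product norm), in the form needed to compose with `HasFDerivAt.clm_comp` below;
the entrywise tree version cannot be invoked verbatim here because this file puts the scoped `linftyOp` norm on
`Matrix p p ℝ` (TECHNICAL NOTE).  Magnus–Neudecker 2019, Ch. 8, Thm. 8.1. [cite: MagnusNeudecker2019, Ch. 8 Thm. 8.1] -/
theorem fderiv_det_apply (A H : Matrix p p ℝ) (hA : IsUnit A.det) :
    fderiv ℝ (fun M : Matrix p p ℝ => M.det) A H = A.det * (A⁻¹ * H).trace := by
  have hline : HasDerivAt (fun t : ℝ => A + t • H) H 0 :=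
    (((hasDerivAt_id' (0 : ℝ)).smul_const H).const_add A).congr_deriv (one_smul _ _)
  have h1 : HasDerivAt ((fun M : Matrix p p ℝ => M.det) ∘ fun t : ℝ => A + t • H)
      (fderiv ℝ (fun M : Matrix p p ℝ => M.det) A H) 0 :=
    (hasFDerivAt_det A).comp_hasDerivAt_of_eq (x := (0 : ℝ)) hline (by simp)
  exact h1.unique (hasDerivAt_det_add_smul A H hA)

/-- First variation of `log det` on the matrix algebra: `D(log det)(A)[H] = tr(A⁻¹H)` for nonsingular `A` — the
logarithmic form of Jacobi's formula (tree: `Literature.Analysis.Calculus.hasFDerivAt_det_apply_eq_det_mul_trace`,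
`MatrixFieldDeriv.lean`; curve form `Literature.Analysis.Calculus.hasDerivAt_log_det`, `JacobiFormula.lean`), restated
as a `HasFDerivAt` on the normed space `Matrix p p ℝ` with derivative the CLM `trMul A⁻¹`.
Magnus–Neudecker 2019, Ch. 8, Thm. 8.1. [cite: MagnusNeudecker2019, Ch. 8 Thm. 8.1] -/
theorem hasFDerivAt_log_det (A : Matrix p p ℝ) (hA : IsUnit A.det) :
    HasFDerivAt (fun M : Matrix p p ℝ => Real.log M.det) (trMul A⁻¹) A := by
  have hne : A.det ≠ 0 := hA.ne_zero
  have h := (Real.hasDerivAt_log hne).comp_hasFDerivAt A (hasFDerivAt_det A)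
  refine h.congr_fderiv ?_
  ext H
  simp only [FunLike.coe_smul, Pi.smul_apply, smul_eq_mul, trMul_apply]
  rw [fderiv_det_apply A H hA, inv_mul_cancel_left₀ hne]

/-- Derivative of the matrix inverse AS A MATRIX-VALUED MAP: `D(A ↦ A⁻¹)(A)[H] = −A⁻¹HA⁻¹` for nonsingular `A`,
i.e. `HasFDerivAt Matrix.inv (−mulLeftRight A⁻¹ A⁻¹) A` on the normed algebra `Matrix p p ℝ` (operator norm; proof =
Mathlib's `hasFDerivAt_ringInverse` transported to `Matrix.inv`).  This RESTATES, in `Matrix →L Matrix` form, the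
tree's ENTRYWISE rule `Literature.Analysis.Calculus.hasFDerivAt_inv_apply` / `fderiv_inv_apply` (`MatrixFieldDeriv.lean`,
fields `E → ι → ι → ℝ`, product norm): the second variation below needs the inverse rule as one continuous linear map
to chain with `HasFDerivAt.clm_comp`, which the entrywise statement does not provide without reassembly and a change of
norm (TECHNICAL NOTE).  Magnus–Neudecker 2019, Ch. 8, §8.4 (Thm. 8.3). [cite: MagnusNeudecker2019, Ch. 8 §8.4] -/
theorem hasFDerivAt_inv (A : Matrix p p ℝ) (hA : IsUnit A.det) :
    HasFDerivAt (fun M : Matrix p p ℝ => M⁻¹)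
      (-ContinuousLinearMap.mulLeftRight ℝ (Matrix p p ℝ) A⁻¹ A⁻¹) A := by
  haveI : CompleteSpace (Matrix p p ℝ) := FiniteDimensional.complete ℝ (Matrix p p ℝ)
  obtain ⟨u, hu⟩ := (Matrix.isUnit_iff_isUnit_det A).2 hA
  have h := hasFDerivAt_ringInverse (𝕜 := ℝ) u
  have hf : (fun M : Matrix p p ℝ => M⁻¹) = Ring.inverse := funext fun M => Matrix.nonsing_inv_eq_ringInverse M
  have hinv : ((u⁻¹ : (Matrix p p ℝ)ˣ) : Matrix p p ℝ) = A⁻¹ := by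
    rw [← Ring.inverse_unit, hu, ← Matrix.nonsing_inv_eq_ringInverse]
  rw [hf, ← hinv, ← hu]
  exact h

/-! ### The second variation of `log det` along a `C²` matrix-valued map

For `K : E → Matrix p p ℝ` twice continuously differentiable at `x₀` with `K(x₀)` nonsingular,
`D²(log det K)(x₀)[u,v] = tr(K₀⁻¹ D²K(x₀)[u,v]) − tr(K₀⁻¹ DK(x₀)[u] K₀⁻¹ DK(x₀)[v])`, `K₀ = K(x₀)`
(chain rule through `log ∘ det` and the derivative of the inverse). -/

variable {E : Type*} [NormedAddCommGroup E] [NormedSpace ℝ E]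

/-- Local first-derivative data of a map `C²` at a point: a derivative field `K'` valid on a neighbourhood and `C¹`
at the point (Mathlib's `contDiffAt_succ_iff_hasFDerivAt`). [folklore] -/
theorem exists_local_fderiv {F : Type*} [NormedAddCommGroup F] [NormedSpace ℝ F] {K : E → F} {x₀ : E}
    (hK : ContDiffAt ℝ 2 K x₀) :
    ∃ K' : E → E →L[ℝ] F, (∀ᶠ x in 𝓝 x₀, HasFDerivAt K (K' x) x) ∧ ContDiffAt ℝ 1 K' x₀ := by
  have hK1 : ContDiffAt ℝ ((1 : ℕ) + 1) K x₀ := by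
    have h2 : ((1 : ℕ) : WithTop ℕ∞) + 1 = 2 := by norm_num
    rw [h2]; exact hK
  obtain ⟨K', ⟨U, hU, hK'⟩, hK'1⟩ := contDiffAt_succ_iff_hasFDerivAt.1 hK1
  exact ⟨K', Filter.eventually_of_mem hU hK', by simpa using hK'1⟩

/-- Entries of a Fréchet derivative are the Fréchet derivatives of the entries. [folklore] -/
theorem hasFDerivAt_entry {K : E → Matrix p p ℝ} {K' : E →L[ℝ] Matrix p p ℝ} {x : E}
    (h : HasFDerivAt K K' x) (i j : p) :
    HasFDerivAt (fun y => K y i j) ((entryCLM i j).comp K') x :=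
  (entryCLM i j).hasFDerivAt.comp x h

/-- `(DK(x₀) u)ᵢⱼ = D(Kᵢⱼ)(x₀) u` for `K` differentiable at `x₀`. [folklore] -/
theorem fderiv_apply_entry {K : E → Matrix p p ℝ} {x₀ : E} (hK : DifferentiableAt ℝ K x₀) (i j : p) (u : E) :
    fderiv ℝ (fun y => K y i j) x₀ u = fderiv ℝ K x₀ u i j := by
  rw [(hasFDerivAt_entry hK.hasFDerivAt i j).fderiv]
  rfl

/-- `(D²K(x₀)[u,v])ᵢⱼ = D²(Kᵢⱼ)(x₀)[u,v]` for `K` of class `C²` at `x₀`. [folklore] -/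
theorem fderiv_fderiv_apply_entry {K : E → Matrix p p ℝ} {x₀ : E} (hK : ContDiffAt ℝ 2 K x₀) (i j : p)
    (u v : E) :
    fderiv ℝ (fderiv ℝ (fun y => K y i j)) x₀ u v = fderiv ℝ (fderiv ℝ K) x₀ u v i j := by
  obtain ⟨K', hK', hK'1⟩ := exists_local_fderiv hK
  have hfK : fderiv ℝ K =ᶠ[𝓝 x₀] K' := hK'.mono fun x hx => hx.fderiv
  have h1 : fderiv ℝ (fun y => K y i j) =ᶠ[𝓝 x₀] fun x => (entryCLM i j).comp (K' x) :=
    hK'.mono fun x hx => (hasFDerivAt_entry hx i j).fderiv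
  have hd : HasFDerivAt K' (fderiv ℝ K' x₀) x₀ := (hK'1.differentiableAt one_ne_zero).hasFDerivAt
  have h2 : HasFDerivAt (fun x => (entryCLM i j).comp (K' x))
      ((ContinuousLinearMap.compL ℝ E (Matrix p p ℝ) ℝ (entryCLM i j)).comp (fderiv ℝ K' x₀)) x₀ := by
    have h := (hasFDerivAt_const (entryCLM i j) x₀).clm_comp hd
    simpa using h
  rw [(h2.congr_of_eventuallyEq h1).fderiv, hfK.fderiv_eq]
  rfl

/-- **Second variation of `log det`** along a `C²` matrix-valued map at a nonsingular point:
`D²(log det K)(x₀)[u,v] = tr(K₀⁻¹·D²K(x₀)[u,v]) − tr(K₀⁻¹·DK(x₀)[u]·K₀⁻¹·DK(x₀)[v])`. [folklore] -/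
theorem fderiv_fderiv_log_det {K : E → Matrix p p ℝ} {x₀ : E} (hK : ContDiffAt ℝ 2 K x₀)
    (h0 : IsUnit (K x₀).det) (u v : E) :
    fderiv ℝ (fderiv ℝ (fun x => Real.log (K x).det)) x₀ u v =
      ((K x₀)⁻¹ * fderiv ℝ (fderiv ℝ K) x₀ u v).trace
        - ((K x₀)⁻¹ * fderiv ℝ K x₀ u * (K x₀)⁻¹ * fderiv ℝ K x₀ v).trace := by
  obtain ⟨K', hK', hK'1⟩ := exists_local_fderiv hK
  have hfK : fderiv ℝ K =ᶠ[𝓝 x₀] K' := hK'.mono fun x hx => hx.fderiv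
  have hK0 : HasFDerivAt K (K' x₀) x₀ := hK'.self_of_nhds
  have hfK0 : fderiv ℝ K x₀ = K' x₀ := hK0.fderiv
  have hd : HasFDerivAt K' (fderiv ℝ K' x₀) x₀ := (hK'1.differentiableAt one_ne_zero).hasFDerivAt
  -- nonsingularity persists near `x₀`
  have hunit : ∀ᶠ x in 𝓝 x₀, IsUnit (K x).det := by
    have hc : ContinuousAt (fun x => (K x).det) x₀ := (contDiff_det.contDiffAt.comp x₀ hK).continuousAt
    exact (hc.eventually_ne h0.ne_zero).mono fun x hx => isUnit_iff_ne_zero.2 hx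
  -- the first variation, as a field of continuous linear maps near `x₀`
  have hff : fderiv ℝ (fun x => Real.log (K x).det) =ᶠ[𝓝 x₀] fun x => (trMul (K x)⁻¹).comp (K' x) :=
    (hunit.and hK').mono fun x hx => ((hasFDerivAt_log_det (K x) hx.1).comp x hx.2).fderiv
  -- derivative of `x ↦ (H ↦ tr((K x)⁻¹ H))` at `x₀`
  have hc : HasFDerivAt (fun x => trMul (K x)⁻¹)
      ((ContinuousLinearMap.compL ℝ (Matrix p p ℝ) (Matrix p p ℝ) ℝ trCLM).comp
        ((ContinuousLinearMap.mul ℝ (Matrix p p ℝ)).comp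
          ((-ContinuousLinearMap.mulLeftRight ℝ (Matrix p p ℝ) (K x₀)⁻¹ (K x₀)⁻¹).comp (K' x₀)))) x₀ :=
    (ContinuousLinearMap.compL ℝ (Matrix p p ℝ) (Matrix p p ℝ) ℝ trCLM).hasFDerivAt.comp x₀
      ((ContinuousLinearMap.mul ℝ (Matrix p p ℝ)).hasFDerivAt.comp x₀ ((hasFDerivAt_inv (K x₀) h0).comp x₀ hK0))
  have h2 := (hc.clm_comp hd).congr_of_eventuallyEq hff
  rw [h2.fderiv, hfK.fderiv_eq, hfK0]
  simp only [_root_.add_apply, ContinuousLinearMap.comp_apply, ContinuousLinearMap.compL_apply,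
    ContinuousLinearMap.flip_apply, _root_.neg_apply, ContinuousLinearMap.mulLeftRight_apply,
    ContinuousLinearMap.mul_apply', trMul_apply, trCLM_apply, Matrix.neg_mul, Matrix.trace_neg]
  ring

/-- A matrix-valued map is `C^k` at a point when all its entries are. [folklore] -/
theorem contDiffAt_matrix {k : WithTop ℕ∞} {K : E → Matrix p p ℝ} {x₀ : E}
    (h : ∀ i j, ContDiffAt ℝ k (fun x => K x i j) x₀) : ContDiffAt ℝ k K x₀ := by
  have hK : K = fun x => ∑ i, ∑ j, K x i j • Matrix.single i j (1 : ℝ) := by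
    funext x
    conv_lhs => rw [Matrix.matrix_eq_sum_single (K x)]
    refine Finset.sum_congr rfl fun i _ => Finset.sum_congr rfl fun j _ => ?_
    rw [Matrix.smul_single, smul_eq_mul, mul_one]
  rw [hK]
  exact ContDiffAt.sum fun i _ => ContDiffAt.sum fun j _ => (h i j).smul contDiffAt_const

/-- **Second variation of `log det`, entrywise data** (no matrix norm in the statement): for `K : E → Matrix p p ℝ`
with every entry `C²` at `x₀` and `det K(x₀) ≠ 0`,
`D²(log det K)(x₀)[u,v] = tr(K₀⁻¹ ∂ᵤ∂ᵥK) − tr(K₀⁻¹ ∂ᵤK K₀⁻¹ ∂ᵥK)` with the derivative matrices formed entry by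
entry. [folklore] -/
theorem fderiv_fderiv_log_det_entrywise {K : E → Matrix p p ℝ} {x₀ : E}
    (hK : ∀ i j, ContDiffAt ℝ 2 (fun x => K x i j) x₀) (h0 : (K x₀).det ≠ 0) (u v : E) :
    fderiv ℝ (fderiv ℝ (fun x => Real.log (K x).det)) x₀ u v =
      ((K x₀)⁻¹ * Matrix.of (fun i j => fderiv ℝ (fderiv ℝ (fun x => K x i j)) x₀ u v)).trace
        - ((K x₀)⁻¹ * Matrix.of (fun i j => fderiv ℝ (fun x => K x i j) x₀ u) * (K x₀)⁻¹ *
            Matrix.of (fun i j => fderiv ℝ (fun x => K x i j) x₀ v)).trace := by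
  have hKm : ContDiffAt ℝ 2 K x₀ := contDiffAt_matrix hK
  have hKd : DifferentiableAt ℝ K x₀ := hKm.differentiableAt two_ne_zero
  have e1 : ∀ w : E, Matrix.of (fun i j => fderiv ℝ (fun x => K x i j) x₀ w) = fderiv ℝ K x₀ w := fun w => by
    ext i j; rw [Matrix.of_apply, fderiv_apply_entry hKd]
  have e2 : Matrix.of (fun i j => fderiv ℝ (fderiv ℝ (fun x => K x i j)) x₀ u v) = fderiv ℝ (fderiv ℝ K) x₀ u v := by
    ext i j; rw [Matrix.of_apply, fderiv_fderiv_apply_entry hKm]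
  rw [e1, e1, e2]
  exact fderiv_fderiv_log_det hKm (isUnit_iff_ne_zero.2 h0) u v

end MatrixCalculus

/-! ## Part 2 — block (KKT) algebra: the two traces over `K₀⁻¹ = [[G, H], [H′, T]]` and `∂K = [[∂Δ, ∂Qᵀ], [∂Q, 0]]` -/

section BlockAlgebra

variable {q r : Type*} [Fintype q] [Fintype r]

/-- The trace of a block matrix is the sum of the traces of its diagonal blocks. [folklore] -/
theorem trace_fromBlocks (A : Matrix q q ℝ) (B : Matrix q r ℝ) (C : Matrix r q ℝ) (D : Matrix r r ℝ) :
    (Matrix.fromBlocks A B C D).trace = A.trace + D.trace := by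
  simp [Matrix.trace, Fintype.sum_sum_type]

/-- `tr(Aᵀ Bᵀ Cᵀ Dᵀ) = tr(D C B A)`. [folklore] -/
theorem trace_transpose_mul₄ {s t u : Type*} [Fintype s] [Fintype t] [Fintype u]
    (A : Matrix s q ℝ) (B : Matrix t s ℝ) (C : Matrix u t ℝ) (D : Matrix q u ℝ) :
    (Aᵀ * (Bᵀ * (Cᵀ * Dᵀ))).trace = (D * (C * (B * A))).trace := by
  rw [← Matrix.trace_transpose]
  simp [Matrix.transpose_mul, Matrix.mul_assoc]

/-- `tr(A B C D) = tr(D A B C)`. [folklore] -/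
theorem trace_mul_cycle₄ {s t u : Type*} [Fintype s] [Fintype t] [Fintype u]
    (A : Matrix q s ℝ) (B : Matrix s t ℝ) (C : Matrix t u ℝ) (D : Matrix u q ℝ) :
    (A * (B * (C * D))).trace = (D * (A * (B * C))).trace := by
  rw [show A * (B * (C * D)) = A * (B * C) * D by simp [Matrix.mul_assoc], Matrix.trace_mul_comm]

/-- `tr(A B) = tr(B A)` in right-associated triple form: `tr(A (B C)) = tr(C (A B))`. [folklore] -/
theorem trace_mul_cycle₃ {s t : Type*} [Fintype s] [Fintype t]
    (A : Matrix q s ℝ) (B : Matrix s t ℝ) (C : Matrix t q ℝ) :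
    (A * (B * C)).trace = (C * (A * B)).trace := by
  rw [← Matrix.mul_assoc, Matrix.trace_mul_comm]

/-- FIRST TRACE, general blocks: `tr([[G,H],[H′,T]]·[[Δ₁,Q₁ᵀ],[Q₁,0]]) = tr(GΔ₁) + tr(HQ₁) + tr(H′Q₁ᵀ)`. [folklore] -/
theorem trace_blockInv_mul_variation (G : Matrix q q ℝ) (H : Matrix q r ℝ) (H' : Matrix r q ℝ) (T : Matrix r r ℝ)
    (Δ₁ : Matrix q q ℝ) (Q₁ : Matrix r q ℝ) :
    (Matrix.fromBlocks G H H' T * Matrix.fromBlocks Δ₁ Q₁ᵀ Q₁ 0).trace =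
      (G * Δ₁).trace + (H * Q₁).trace + (H' * Q₁ᵀ).trace := by
  simp [Matrix.fromBlocks_multiply, trace_fromBlocks, Matrix.trace_add]

/-- SECOND TRACE, general blocks: `tr(W∂₁K·W∂₂K)` for `W = [[G,H],[H′,T]]`, `∂ₐK = [[Δₐ,Qₐᵀ],[Qₐ,0]]`, as the sum of
the four diagonal-block traces. [folklore] -/
theorem trace_blockInv_mul_variation_sq (G : Matrix q q ℝ) (H : Matrix q r ℝ) (H' : Matrix r q ℝ) (T : Matrix r r ℝ)
    (Δ₁ Δ₂ : Matrix q q ℝ) (Q₁ Q₂ : Matrix r q ℝ) :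
    (Matrix.fromBlocks G H H' T * Matrix.fromBlocks Δ₁ Q₁ᵀ Q₁ 0 * Matrix.fromBlocks G H H' T *
        Matrix.fromBlocks Δ₂ Q₂ᵀ Q₂ 0).trace =
      ((G * Δ₁ + H * Q₁) * (G * Δ₂ + H * Q₂)).trace + (G * Q₁ᵀ * (H' * Δ₂ + T * Q₂)).trace
        + ((H' * Δ₁ + T * Q₁) * (G * Q₂ᵀ)).trace + (H' * Q₁ᵀ * (H' * Q₂ᵀ)).trace := by
  rw [show Matrix.fromBlocks G H H' T * Matrix.fromBlocks Δ₁ Q₁ᵀ Q₁ 0 * Matrix.fromBlocks G H H' T *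
        Matrix.fromBlocks Δ₂ Q₂ᵀ Q₂ 0 = (Matrix.fromBlocks G H H' T * Matrix.fromBlocks Δ₁ Q₁ᵀ Q₁ 0) *
        (Matrix.fromBlocks G H H' T * Matrix.fromBlocks Δ₂ Q₂ᵀ Q₂ 0) by rw [Matrix.mul_assoc]]
  simp [Matrix.fromBlocks_multiply, trace_fromBlocks, Matrix.trace_add, add_assoc]

/-- **THE MASTER FORMULA (M)** (prose: `run/shared/lean/pub/pub-balaban/BETA/AN2-pv09.md` L3.3, here kernel-checked
sign by sign): with a SYMMETRIC block inverse `K₀⁻¹ = [[G, H], [Hᵀ, −S]]` (`G`, `S` symmetric) and symmetric first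
variations `Δ₁ = ∂ᵢΔ`, `Δ₂ = ∂ⱼΔ`,
`−½[tr(K₀⁻¹∂ᵢ∂ⱼK) − tr(K₀⁻¹∂ᵢK K₀⁻¹∂ⱼK)] = −½tr(GΔᵢⱼ) + ½tr(GΔᵢGΔⱼ) − tr(HQᵢⱼ) + tr(HQᵢHQⱼ) − tr(GQᵢᵀSQⱼ)
+ tr(GΔᵢHQⱼ) + tr(GΔⱼHQᵢ)`. [folklore] -/
theorem master_formula (G : Matrix q q ℝ) (H : Matrix q r ℝ) (S : Matrix r r ℝ)
    (Δ₁ Δ₂ Δ₁₂ : Matrix q q ℝ) (Q₁ Q₂ Q₁₂ : Matrix r q ℝ)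
    (hG : G.IsSymm) (hS : S.IsSymm) (hΔ₁ : Δ₁.IsSymm) (hΔ₂ : Δ₂.IsSymm) :
    -(1 / 2 : ℝ) * ((Matrix.fromBlocks G H Hᵀ (-S) * Matrix.fromBlocks Δ₁₂ Q₁₂ᵀ Q₁₂ 0).trace
        - (Matrix.fromBlocks G H Hᵀ (-S) * Matrix.fromBlocks Δ₁ Q₁ᵀ Q₁ 0 * Matrix.fromBlocks G H Hᵀ (-S) *
            Matrix.fromBlocks Δ₂ Q₂ᵀ Q₂ 0).trace) =
      -(1 / 2 : ℝ) * (G * Δ₁₂).trace + (1 / 2 : ℝ) * (G * Δ₁ * G * Δ₂).trace - (H * Q₁₂).trace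
        + (H * Q₁ * H * Q₂).trace - (G * Q₁ᵀ * S * Q₂).trace + (G * Δ₁ * H * Q₂).trace
        + (G * Δ₂ * H * Q₁).trace := by
  rw [trace_blockInv_mul_variation, trace_blockInv_mul_variation_sq]
  simp only [Matrix.mul_add, Matrix.add_mul, Matrix.neg_mul, Matrix.mul_neg, Matrix.trace_add, Matrix.trace_neg,
    Matrix.mul_assoc]
  -- the five trace identities that use the symmetries
  have t1 : (Hᵀ * Q₁₂ᵀ).trace = (H * Q₁₂).trace := by
    rw [← Matrix.transpose_mul, Matrix.trace_transpose, Matrix.trace_mul_comm]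
  have ta : (G * (Q₁ᵀ * (Hᵀ * Δ₂))).trace = (G * (Δ₂ * (H * Q₁))).trace := by
    conv_lhs => rw [← hG.eq, ← hΔ₂.eq]
    rw [trace_transpose_mul₄, trace_mul_cycle₄]
  have tb : (Hᵀ * (Δ₁ * (G * Q₂ᵀ))).trace = (G * (Δ₁ * (H * Q₂))).trace := by
    conv_lhs => rw [← hG.eq, ← hΔ₁.eq]
    rw [trace_transpose_mul₄, trace_mul_cycle₄, trace_mul_cycle₄, trace_mul_cycle₄]
  have tc : (S * (Q₁ * (G * Q₂ᵀ))).trace = (G * (Q₁ᵀ * (S * Q₂))).trace := by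
    conv_lhs => rw [← hG.eq, ← hS.eq, ← Matrix.transpose_transpose Q₁]
    rw [trace_transpose_mul₄, trace_mul_cycle₄, trace_mul_cycle₄, trace_mul_cycle₄]
  have td : (Hᵀ * (Q₁ᵀ * (Hᵀ * Q₂ᵀ))).trace = (H * (Q₁ * (H * Q₂))).trace := by
    rw [trace_transpose_mul₄, trace_mul_cycle₄, trace_mul_cycle₄, trace_mul_cycle₄]
  have te : (H * (Q₁ * (G * Δ₂))).trace = (G * (Δ₂ * (H * Q₁))).trace := by
    rw [trace_mul_cycle₄, trace_mul_cycle₄]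
  rw [t1, ta, tb, tc, td, te]
  ring

end BlockAlgebra

/-! ## Part 2b — the EXPLICIT block inverse of the bordered matrix (prose `BETA/AN2-pv09.md` L3.2, here a kernel theorem):
`[[Δ, Qᵀ],[Q, 0]]⁻¹ = [[𝒢, ℋ],[ℋ♭, −𝒮]]` with `𝒢 = C(CᵀΔC)⁻¹Cᵀ`, `Q⁺ = Qᵀ(QQᵀ)⁻¹`, `ℋ = (1 − 𝒢Δ)Q⁺`,
`ℋ♭ = (QQᵀ)⁻¹Q(1 − Δ𝒢)` (`= ℋᵀ` for symmetric `Δ`), `𝒮 = (QQᵀ)⁻¹Q(Δ − Δ𝒢Δ)Q⁺`, for ANY `C` with `QC = 0` and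
`CᵀC`, `QQᵀ`, `CᵀΔC` nonsingular on complementary index types (`κ ≃ ν ⊕ τ`: the columns of `C` then span `ker Q`) -/

section BlockInverse

variable {κ ν τ : Type*} [Fintype κ] [Fintype ν] [Fintype τ] [DecidableEq κ] [DecidableEq ν] [DecidableEq τ]

/-- PROJECTOR DECOMPOSITION `C(CᵀC)⁻¹Cᵀ + Qᵀ(QQᵀ)⁻¹Q = 1`: for `QC = 0` with `CᵀC` and `QQᵀ` nonsingular and
`κ ≃ ν ⊕ τ`, the change of variables `[C | Qᵀ]` has the two-sided inverse `[(CᵀC)⁻¹Cᵀ ; (QQᵀ)⁻¹Q]` (Mathlib's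
`fromCols_mul_fromRows_eq_one_comm`). [folklore] -/
theorem proj_add_proj (e : κ ≃ ν ⊕ τ) (Q : Matrix τ κ ℝ) (C : Matrix κ ν ℝ) (hQC : Q * C = 0)
    (hA : IsUnit (Cᵀ * C).det) (hM : IsUnit (Q * Qᵀ).det) :
    C * (Cᵀ * C)⁻¹ * Cᵀ + Qᵀ * (Q * Qᵀ)⁻¹ * Q = 1 := by
  have hCQ : Cᵀ * Qᵀ = 0 := by rw [← Matrix.transpose_mul, hQC, Matrix.transpose_zero]
  have h11 : (Cᵀ * C)⁻¹ * Cᵀ * C = 1 := by rw [Matrix.mul_assoc, Matrix.nonsing_inv_mul _ hA]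
  have h12 : (Cᵀ * C)⁻¹ * Cᵀ * Qᵀ = 0 := by rw [Matrix.mul_assoc, hCQ, Matrix.mul_zero]
  have h21 : (Q * Qᵀ)⁻¹ * Q * C = 0 := by rw [Matrix.mul_assoc, hQC, Matrix.mul_zero]
  have h22 : (Q * Qᵀ)⁻¹ * Q * Qᵀ = 1 := by rw [Matrix.mul_assoc, Matrix.nonsing_inv_mul _ hM]
  have hLX : Matrix.fromRows ((Cᵀ * C)⁻¹ * Cᵀ) ((Q * Qᵀ)⁻¹ * Q) * Matrix.fromCols C Qᵀ = 1 := by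
    rw [Matrix.fromRows_mul_fromCols, h11, h12, h21, h22, Matrix.fromBlocks_one]
  have hXL := (Matrix.fromCols_mul_fromRows_eq_one_comm e C Qᵀ ((Cᵀ * C)⁻¹ * Cᵀ) ((Q * Qᵀ)⁻¹ * Q)).mpr hLX
  rw [Matrix.fromCols_mul_fromRows] at hXL
  simpa only [Matrix.mul_assoc] using hXL

/-- `𝒢 := C(CᵀΔC)⁻¹Cᵀ` — the constrained covariance (AN2-pv09 L3.2; `C^{(k)}` of [Balaban1985BackgroundPropagators]
(3.158) in B9's variables, as a MODEL object). [folklore] -/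
def cov (Δ : Matrix κ κ ℝ) (C : Matrix κ ν ℝ) : Matrix κ κ ℝ := C * (Cᵀ * Δ * C)⁻¹ * Cᵀ

/-- `Q⁺ := Qᵀ(QQᵀ)⁻¹` — the right inverse of an onto constraint. [folklore] -/
def pinv (Q : Matrix τ κ ℝ) : Matrix κ τ ℝ := Qᵀ * (Q * Qᵀ)⁻¹

/-- `ℋ := (1 − 𝒢Δ)Q⁺` — the linear minimiser `w ↦ argmin {½⟨v,Δv⟩ : Qv = w}` (AN2-pv09 L3.2). [folklore] -/
def minimiser (Δ : Matrix κ κ ℝ) (Q : Matrix τ κ ℝ) (C : Matrix κ ν ℝ) : Matrix κ τ ℝ :=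
  (1 - cov Δ C * Δ) * pinv Q

/-- `ℋ♭ := (QQᵀ)⁻¹Q(1 − Δ𝒢)` — the lower-left block (equal to `ℋᵀ` when `Δ` is symmetric,
`cominimiser_eq_transpose`). [folklore] -/
def cominimiser (Δ : Matrix κ κ ℝ) (Q : Matrix τ κ ℝ) (C : Matrix κ ν ℝ) : Matrix τ κ ℝ :=
  (Q * Qᵀ)⁻¹ * Q * (1 - Δ * cov Δ C)

/-- `𝒮 := (QQᵀ)⁻¹Q(Δ − Δ𝒢Δ)Q⁺` (AN2-pv09 L3.2: `Q⁺ᵀ(Δ − Δ𝒢Δ)Q⁺`). [folklore] -/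
def schur (Δ : Matrix κ κ ℝ) (Q : Matrix τ κ ℝ) (C : Matrix κ ν ℝ) : Matrix τ τ ℝ :=
  (Q * Qᵀ)⁻¹ * Q * (Δ - Δ * cov Δ C * Δ) * pinv Q

/-- The candidate inverse `[[𝒢, ℋ],[ℋ♭, −𝒮]]` of the bordered matrix. [folklore] -/
def blockInv (Δ : Matrix κ κ ℝ) (Q : Matrix τ κ ℝ) (C : Matrix κ ν ℝ) : Matrix (κ ⊕ τ) (κ ⊕ τ) ℝ :=
  Matrix.fromBlocks (cov Δ C) (minimiser Δ Q C) (cominimiser Δ Q C) (-schur Δ Q C)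

/-- **BLOCK INVERSE OF THE BORDERED MATRIX, the direct check** (no symmetry of `Δ` needed): for `QC = 0` with
`CᵀC`, `QQᵀ`, `CᵀΔC` nonsingular and `κ ≃ ν ⊕ τ`,  `[[Δ, Qᵀ],[Q, 0]] · [[𝒢, ℋ],[ℋ♭, −𝒮]] = 1`
(uses `Q𝒢 = 0`, `CᵀΔ𝒢 = Cᵀ`, `QQ⁺ = 1` and the projector decomposition `proj_add_proj`). [folklore] -/
theorem kkt_mul_blockInv (e : κ ≃ ν ⊕ τ) (Δ : Matrix κ κ ℝ) (Q : Matrix τ κ ℝ) (C : Matrix κ ν ℝ)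
    (hQC : Q * C = 0) (hA : IsUnit (Cᵀ * C).det) (hM : IsUnit (Q * Qᵀ).det) (hΓ : IsUnit (Cᵀ * Δ * C).det) :
    Matrix.fromBlocks Δ Qᵀ Q 0 * blockInv Δ Q C = 1 := by
  have proj := proj_add_proj e Q C hQC hA hM
  have hP : Qᵀ * (Q * Qᵀ)⁻¹ * Q = 1 - C * (Cᵀ * C)⁻¹ * Cᵀ := eq_sub_of_add_eq' proj
  have f1 : Q * cov Δ C = 0 := by
    simp only [cov, ← Matrix.mul_assoc, hQC, Matrix.zero_mul]
  have f2 : Cᵀ * Δ * cov Δ C = Cᵀ := by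
    calc Cᵀ * Δ * cov Δ C = (Cᵀ * Δ * C) * (Cᵀ * Δ * C)⁻¹ * Cᵀ := by simp only [cov, Matrix.mul_assoc]
      _ = Cᵀ := by rw [Matrix.mul_nonsing_inv _ hΓ, Matrix.one_mul]
  have f3 : C * (Cᵀ * C)⁻¹ * Cᵀ * (Δ * cov Δ C) = C * (Cᵀ * C)⁻¹ * Cᵀ := by
    calc C * (Cᵀ * C)⁻¹ * Cᵀ * (Δ * cov Δ C) = C * (Cᵀ * C)⁻¹ * (Cᵀ * Δ * cov Δ C) := by
          simp only [Matrix.mul_assoc]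
      _ = C * (Cᵀ * C)⁻¹ * Cᵀ := by rw [f2]
  have f4 : C * (Cᵀ * C)⁻¹ * Cᵀ * (Δ - Δ * cov Δ C * Δ) = 0 := by
    calc C * (Cᵀ * C)⁻¹ * Cᵀ * (Δ - Δ * cov Δ C * Δ)
          = C * (Cᵀ * C)⁻¹ * (Cᵀ * Δ - (Cᵀ * Δ * cov Δ C) * Δ) := by
          simp only [Matrix.mul_assoc, Matrix.mul_sub]
      _ = 0 := by rw [f2, sub_self, Matrix.mul_zero]
  have f5 : Q * pinv Q = 1 := by
    rw [pinv, ← Matrix.mul_assoc, Matrix.mul_nonsing_inv _ hM]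
  rw [blockInv, Matrix.fromBlocks_multiply, ← Matrix.fromBlocks_one]
  congr 1
  · -- upper left: `Δ𝒢 + Qᵀℋ♭ = 1`
    calc Δ * cov Δ C + Qᵀ * cominimiser Δ Q C
          = Δ * cov Δ C + Qᵀ * (Q * Qᵀ)⁻¹ * Q * (1 - Δ * cov Δ C) := by
          simp only [cominimiser, Matrix.mul_assoc]
      _ = Δ * cov Δ C + (1 - C * (Cᵀ * C)⁻¹ * Cᵀ) * (1 - Δ * cov Δ C) := by rw [hP]
      _ = 1 := by
          rw [Matrix.sub_mul, Matrix.one_mul, Matrix.mul_sub, Matrix.mul_one, f3]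
          abel
  · -- upper right: `Δℋ − Qᵀ𝒮 = 0`
    calc Δ * minimiser Δ Q C + Qᵀ * -schur Δ Q C
          = (1 - Qᵀ * (Q * Qᵀ)⁻¹ * Q) * (Δ - Δ * cov Δ C * Δ) * pinv Q := by
          simp only [minimiser, schur, Matrix.mul_neg, Matrix.sub_mul, Matrix.mul_sub, Matrix.one_mul,
            Matrix.mul_assoc]
          abel
      _ = 0 := by rw [hP, sub_sub_cancel, f4, Matrix.zero_mul]
  · -- lower left: `Q𝒢 = 0`
    rw [f1, Matrix.zero_mul, add_zero]
  · -- lower right: `Qℋ = 1`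
    rw [Matrix.zero_mul, add_zero, minimiser, ← Matrix.mul_assoc, Matrix.mul_sub, Matrix.mul_one,
      ← Matrix.mul_assoc, f1, Matrix.zero_mul, sub_zero, f5]

/-- Hence `[[Δ, Qᵀ],[Q, 0]]⁻¹ = [[𝒢, ℋ],[ℋ♭, −𝒮]]` (Mathlib's `Matrix.inv_eq_right_inv`). [folklore] -/
theorem kkt_inv_eq_blockInv (e : κ ≃ ν ⊕ τ) (Δ : Matrix κ κ ℝ) (Q : Matrix τ κ ℝ) (C : Matrix κ ν ℝ)
    (hQC : Q * C = 0) (hA : IsUnit (Cᵀ * C).det) (hM : IsUnit (Q * Qᵀ).det) (hΓ : IsUnit (Cᵀ * Δ * C).det) :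
    (Matrix.fromBlocks Δ Qᵀ Q 0)⁻¹ = blockInv Δ Q C :=
  Matrix.inv_eq_right_inv (kkt_mul_blockInv e Δ Q C hQC hA hM hΓ)

/-- For SYMMETRIC `Δ` the inverse of the (then symmetric) bordered matrix is symmetric, whence `𝒢ᵀ = 𝒢`, `𝒮ᵀ = 𝒮`
and `ℋ♭ = ℋᵀ`. [folklore] -/
theorem blockInv_symm (e : κ ≃ ν ⊕ τ) (Δ : Matrix κ κ ℝ) (Q : Matrix τ κ ℝ) (C : Matrix κ ν ℝ) (hΔ : Δ.IsSymm)
    (hQC : Q * C = 0) (hA : IsUnit (Cᵀ * C).det) (hM : IsUnit (Q * Qᵀ).det) (hΓ : IsUnit (Cᵀ * Δ * C).det) :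
    (cov Δ C)ᵀ = cov Δ C ∧ cominimiser Δ Q C = (minimiser Δ Q C)ᵀ ∧ (schur Δ Q C)ᵀ = schur Δ Q C := by
  have hK : (Matrix.fromBlocks Δ Qᵀ Q 0)ᵀ = Matrix.fromBlocks Δ Qᵀ Q 0 := by
    rw [Matrix.fromBlocks_transpose, Matrix.transpose_transpose, hΔ.eq, Matrix.transpose_zero]
  have hW : (blockInv Δ Q C)ᵀ = blockInv Δ Q C := by
    rw [← kkt_inv_eq_blockInv e Δ Q C hQC hA hM hΓ, Matrix.transpose_nonsing_inv, hK]
  rw [blockInv, Matrix.fromBlocks_transpose, Matrix.fromBlocks_inj] at hW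
  obtain ⟨h1, -, h3, h4⟩ := hW
  refine ⟨h1, h3.symm, ?_⟩
  rwa [Matrix.transpose_neg, neg_inj] at h4

/-- **THE BLOCK INVERSE IN SYMMETRIC FORM** (AN2-pv09 L3.2): for symmetric `Δ`,
`[[Δ, Qᵀ],[Q, 0]]⁻¹ = [[𝒢, ℋ],[ℋᵀ, −𝒮]]`. [folklore] -/
theorem kkt_inv_eq_fromBlocks (e : κ ≃ ν ⊕ τ) (Δ : Matrix κ κ ℝ) (Q : Matrix τ κ ℝ) (C : Matrix κ ν ℝ)
    (hΔ : Δ.IsSymm) (hQC : Q * C = 0) (hA : IsUnit (Cᵀ * C).det) (hM : IsUnit (Q * Qᵀ).det)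
    (hΓ : IsUnit (Cᵀ * Δ * C).det) :
    (Matrix.fromBlocks Δ Qᵀ Q 0)⁻¹ =
      Matrix.fromBlocks (cov Δ C) (minimiser Δ Q C) (minimiser Δ Q C)ᵀ (-schur Δ Q C) := by
  rw [kkt_inv_eq_blockInv e Δ Q C hQC hA hM hΓ, blockInv, (blockInv_symm e Δ Q C hΔ hQC hA hM hΓ).2.1]

end BlockInverse

end LogDetHessian

/-! ## Part 3 — the one-loop polarization `Beta.polarization` ((1.20) p. 264 of [Balaban1987RG1], model of
`Beta.OneLoop`): Jacobi's second-order formula and the master formula (M) -/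

namespace Family

open LogDetHessian

variable {ι : Type*} [Fintype ι] [DecidableEq ι] {n m : ℕ}

/-- `∂ᵢQ̃(0)`: the first variation of the constraint matrix along the coordinate `e_i`, entry by entry. [folklore] -/
def dQ (F : Family ι n m) (i : ι) : Matrix (Fin m) (Fin n) ℝ :=
  Matrix.of fun a b => fderiv ℝ (fun B => (F B).Q a b) 0 (Pi.single i 1)

/-- `∂ᵢΔ(0)`: the first variation of the fluctuation form along `e_i`, entry by entry. [folklore] -/
def dΔ (F : Family ι n m) (i : ι) : Matrix (Fin n) (Fin n) ℝ :=
  Matrix.of fun a b => fderiv ℝ (fun B => (F B).Δ a b) 0 (Pi.single i 1)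

/-- `∂ᵢ∂ⱼQ̃(0)`: the second variation of the constraint matrix (the operation `hessianAt` of `Beta.OneLoop`, entry by
entry). [folklore] -/
def d2Q (F : Family ι n m) (i j : ι) : Matrix (Fin m) (Fin n) ℝ :=
  Matrix.of fun a b => hessianAt (fun B => (F B).Q a b) i j

/-- `∂ᵢ∂ⱼΔ(0)`, entry by entry. [folklore] -/
def d2Δ (F : Family ι n m) (i j : ι) : Matrix (Fin n) (Fin n) ℝ :=
  Matrix.of fun a b => hessianAt (fun B => (F B).Δ a b) i j

/-- `∂ᵢK(0)` for the bordered matrix `K(B) = [[Δ(B), Q̃(B)ᵀ], [Q̃(B), 0]]`, entry by entry. [folklore] -/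
def dK (F : Family ι n m) (i : ι) : Matrix (Fin n ⊕ Fin m) (Fin n ⊕ Fin m) ℝ :=
  Matrix.of fun a b => fderiv ℝ (fun B => (F B).kkt a b) 0 (Pi.single i 1)

/-- `∂ᵢ∂ⱼK(0)`, entry by entry. [folklore] -/
def d2K (F : Family ι n m) (i j : ι) : Matrix (Fin n ⊕ Fin m) (Fin n ⊕ Fin m) ℝ :=
  Matrix.of fun a b => hessianAt (fun B => (F B).kkt a b) i j

omit [Fintype ι] in
/-- `∂ᵢK = [[∂ᵢΔ, ∂ᵢQ̃ᵀ], [∂ᵢQ̃, 0]]`. [folklore] -/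
theorem dK_eq_fromBlocks (F : Family ι n m) (i : ι) :
    F.dK i = Matrix.fromBlocks (F.dΔ i) (F.dQ i)ᵀ (F.dQ i) 0 := by
  ext (a | a) (b | b) <;> simp [dK, dΔ, dQ, ConstrainedGaussian.kkt]

/-- `∂ᵢ∂ⱼK = [[∂ᵢ∂ⱼΔ, ∂ᵢ∂ⱼQ̃ᵀ], [∂ᵢ∂ⱼQ̃, 0]]`. [folklore] -/
theorem d2K_eq_fromBlocks (F : Family ι n m) (i j : ι) :
    F.d2K i j = Matrix.fromBlocks (F.d2Δ i j) (F.d2Q i j)ᵀ (F.d2Q i j) 0 := by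
  ext (a | a) (b | b) <;> simp [d2K, d2Δ, d2Q, hessianAt, ConstrainedGaussian.kkt]

omit [DecidableEq ι] in
/-- Entries of `B ↦ K(B)` are `C^k` at `0` when the entries of `Q̃(·)`, `Δ(·)` are. [folklore] -/
theorem contDiffAt_kkt_apply (F : Family ι n m) {k : WithTop ℕ∞}
    (hQ : ∀ a b, ContDiffAt ℝ k (fun B => (F B).Q a b) 0) (hΔ : ∀ a b, ContDiffAt ℝ k (fun B => (F B).Δ a b) 0) :
    ∀ a b, ContDiffAt ℝ k (fun B => (F B).kkt a b) 0 := by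
  rintro (a | a) (b | b)
  · simpa [ConstrainedGaussian.kkt] using hΔ a b
  · simpa [ConstrainedGaussian.kkt] using hQ b a
  · simpa [ConstrainedGaussian.kkt] using hQ a b
  · simpa [ConstrainedGaussian.kkt] using (contDiffAt_const : ContDiffAt ℝ k (fun _ : ι → ℝ => (0 : ℝ)) 0)

/-- **JACOBI'S SECOND-ORDER FORMULA FOR THE ONE-LOOP POLARIZATION.**  For a background family whose data `Q̃(B)`,
`Δ(B)` have entries of class `C²` at `B = 0` and whose bordered matrix `K₀ = [[Δ(0), Q̃(0)ᵀ],[Q̃(0), 0]]` is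
nonsingular (e.g. `(F 0).Regular`, unit pv23's `KKTBridge.kkt_det_ne_zero`),
`Π_{ij} = polarization F i j = −½·[tr(K₀⁻¹ ∂ᵢ∂ⱼK) − tr(K₀⁻¹ ∂ᵢK K₀⁻¹ ∂ⱼK)]`
— the second variation of `log Z = ((n−m)/2) log 2π − ½ log|det K|` (the closed form of (1.4) p. 260 that
`Beta.OneLoop` takes as the MODEL), a theorem of finite-dimensional calculus about the model; nothing is asserted about
the series. [folklore] -/
theorem polarization_eq_trace (F : Family ι n m)
    (hQ : ∀ a b, ContDiffAt ℝ 2 (fun B => (F B).Q a b) 0) (hΔ : ∀ a b, ContDiffAt ℝ 2 (fun B => (F B).Δ a b) 0)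
    (hdet : (F 0).kkt.det ≠ 0) (i j : ι) :
    polarization F i j =
      -(1 / 2 : ℝ) * (((F 0).kkt⁻¹ * F.d2K i j).trace - ((F 0).kkt⁻¹ * F.dK i * (F 0).kkt⁻¹ * F.dK j).trace) := by
  have hK := contDiffAt_kkt_apply F hQ hΔ
  -- `g = log det K`, `C²` at `0`
  have hg2 : ContDiffAt ℝ 2 (fun B : ι → ℝ => Real.log (F B).kkt.det) 0 := (contDiffAt_det_kkt F hQ hΔ).log hdet
  have hEq : F.logZ = fun B => ((n : ℝ) - m) / 2 * Real.log (2 * Real.pi)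
      - (1 / 2 : ℝ) * Real.log (F B).kkt.det := by
    funext B
    simp only [Family.logZ, ConstrainedGaussian.logZ, Real.log_abs]
  have hev : ∀ᶠ y in 𝓝 (0 : ι → ℝ), DifferentiableAt ℝ (fun B : ι → ℝ => Real.log (F B).kkt.det) y :=
    (hg2.eventually (by simp)).mono fun y hy => hy.differentiableAt two_ne_zero
  have h1 : fderiv ℝ F.logZ =ᶠ[𝓝 (0 : ι → ℝ)]
      fun y => (-(1 / 2 : ℝ)) • fderiv ℝ (fun B : ι → ℝ => Real.log (F B).kkt.det) y :=
    hev.mono fun y hy => by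
      rw [hEq, fderiv_const_sub, fderiv_const_mul hy]
      exact (neg_smul _ _).symm
  have hdg : DifferentiableAt ℝ (fderiv ℝ (fun B : ι → ℝ => Real.log (F B).kkt.det)) 0 :=
    (hg2.fderiv_right (m := 1) (by norm_num)).differentiableAt one_ne_zero
  have h2 : fderiv ℝ (fderiv ℝ F.logZ) 0 =
      (-(1 / 2 : ℝ)) • fderiv ℝ (fderiv ℝ (fun B : ι → ℝ => Real.log (F B).kkt.det)) 0 := by
    rw [h1.fderiv_eq, fderiv_fun_const_smul hdg]
  have e2 : F.d2K i j = Matrix.of fun a b =>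
      fderiv ℝ (fderiv ℝ (fun B => (F B).kkt a b)) 0 (Pi.single i 1) (Pi.single j 1) := by
    ext a b
    simp [d2K, hessianAt, iteratedFDeriv_two_apply]
  rw [polarization, iteratedFDeriv_two_apply, h2, e2]
  simp only [Matrix.cons_val_zero, Matrix.cons_val_one, FunLike.coe_smul, Pi.smul_apply, smul_eq_mul]
  rw [fderiv_fderiv_log_det_entrywise hK hdet]
  rfl

omit [Fintype ι] in
/-- The first variations of a family of SYMMETRIC forms are symmetric. [folklore] -/
theorem dΔ_isSymm (F : Family ι n m) (hsymm : ∀ᶠ B in 𝓝 (0 : ι → ℝ), (F B).Δ.IsSymm) (i : ι) :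
    (F.dΔ i).IsSymm := by
  unfold Matrix.IsSymm
  ext a b
  have h : (fun B => (F B).Δ b a) =ᶠ[𝓝 (0 : ι → ℝ)] fun B => (F B).Δ a b := hsymm.mono fun B hB => hB.apply a b
  simp [dΔ, h.fderiv_eq]

/-- **THE MASTER FORMULA (M) FOR THE ONE-LOOP POLARIZATION** (prose `BETA/AN2-pv09.md` L3.3; here a kernel theorem):
under the hypotheses of `polarization_eq_trace`, with `Δ(B)` symmetric for every `B` and the (then symmetric) inverse
of the bordered matrix written in blocks `K₀⁻¹ = [[G, H], [Hᵀ, −S]]`,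
`Π_{ij} = −½tr(G∂ᵢ∂ⱼΔ) + ½tr(G∂ᵢΔG∂ⱼΔ) − tr(H∂ᵢ∂ⱼQ̃) + tr(H∂ᵢQ̃H∂ⱼQ̃) − tr(G∂ᵢQ̃ᵀS∂ⱼQ̃) + tr(G∂ᵢΔH∂ⱼQ̃)
+ tr(G∂ⱼΔH∂ᵢQ̃)`.  (`G` = the constrained propagator, `H` = `(1 − GΔ)Q̃⁺`, `S` = `Q̃⁺ᵀ(Δ − ΔGΔ)Q̃⁺` when `K₀⁻¹`
is computed by elimination — AN2-pv09 L3.2; any block decomposition of `K₀⁻¹` of this symmetric shape will do here.)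
[folklore] -/
theorem polarization_master (F : Family ι n m)
    (hQ : ∀ a b, ContDiffAt ℝ 2 (fun B => (F B).Q a b) 0) (hΔ : ∀ a b, ContDiffAt ℝ 2 (fun B => (F B).Δ a b) 0)
    (hdet : (F 0).kkt.det ≠ 0) (hsymm : ∀ᶠ B in 𝓝 (0 : ι → ℝ), (F B).Δ.IsSymm)
    {G : Matrix (Fin n) (Fin n) ℝ} {H : Matrix (Fin n) (Fin m) ℝ} {S : Matrix (Fin m) (Fin m) ℝ}
    (hinv : (F 0).kkt⁻¹ = Matrix.fromBlocks G H Hᵀ (-S)) (i j : ι) :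
    polarization F i j =
      -(1 / 2 : ℝ) * (G * F.d2Δ i j).trace + (1 / 2 : ℝ) * (G * F.dΔ i * G * F.dΔ j).trace - (H * F.d2Q i j).trace
        + (H * F.dQ i * H * F.dQ j).trace - (G * (F.dQ i)ᵀ * S * F.dQ j).trace + (G * F.dΔ i * H * F.dQ j).trace
        + (G * F.dΔ j * H * F.dQ i).trace := by
  -- the inverse of the symmetric bordered matrix is symmetric, hence so are `G` and `S`
  have hKs : (F 0).kkt.IsSymm := (F 0).kkt_isSymm hsymm.self_of_nhds
  have hWs : (Matrix.fromBlocks G H Hᵀ (-S))ᵀ = Matrix.fromBlocks G H Hᵀ (-S) := by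
    rw [← hinv, Matrix.transpose_nonsing_inv, hKs.eq]
  rw [Matrix.fromBlocks_transpose, Matrix.fromBlocks_inj] at hWs
  obtain ⟨hG, -, -, hS'⟩ := hWs
  have hS : S.IsSymm := by
    have h := hS'
    rw [Matrix.transpose_neg, neg_inj] at h
    exact h
  rw [polarization_eq_trace F hQ hΔ hdet, dK_eq_fromBlocks, dK_eq_fromBlocks, d2K_eq_fromBlocks, hinv]
  exact master_formula G H S (F.dΔ i) (F.dΔ j) (F.d2Δ i j) (F.dQ i) (F.dQ j) (F.d2Q i j) hG hS
    (F.dΔ_isSymm hsymm i) (F.dΔ_isSymm hsymm j)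

/-- `polarization_eq_trace` with nonsingularity of `K₀` discharged by REGULARITY of the base point — `(F 0).Regular`
(onto constraint, symmetric form positive on the kernel), via unit pv23's landed `KKTBridge.kkt_det_ne_zero` (used by
name). [folklore] -/
theorem polarization_eq_trace_of_regular (F : Family ι n m)
    (hQ : ∀ a b, ContDiffAt ℝ 2 (fun B => (F B).Q a b) 0) (hΔ : ∀ a b, ContDiffAt ℝ 2 (fun B => (F B).Δ a b) 0)
    (hreg : (F 0).Regular) (i j : ι) :
    polarization F i j =
      -(1 / 2 : ℝ) * (((F 0).kkt⁻¹ * F.d2K i j).trace - ((F 0).kkt⁻¹ * F.dK i * (F 0).kkt⁻¹ * F.dK j).trace) :=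
  polarization_eq_trace F hQ hΔ (KKTBridge.kkt_det_ne_zero (F 0) hreg) i j

/-- THE MASTER FORMULA (M) under REGULARITY of the base point (`(F 0).Regular`, pv23's `KKTBridge.kkt_det_ne_zero`) and
symmetry of `Δ(B)` near `B = 0` — the hypotheses pv16's `FamilyRegularity` / pv25's `OneLoopDictionary` place on a
background family, plus `C²` data. [folklore] -/
theorem polarization_master_of_regular (F : Family ι n m)
    (hQ : ∀ a b, ContDiffAt ℝ 2 (fun B => (F B).Q a b) 0) (hΔ : ∀ a b, ContDiffAt ℝ 2 (fun B => (F B).Δ a b) 0)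
    (hreg : (F 0).Regular) (hsymm : ∀ᶠ B in 𝓝 (0 : ι → ℝ), (F B).Δ.IsSymm)
    {G : Matrix (Fin n) (Fin n) ℝ} {H : Matrix (Fin n) (Fin m) ℝ} {S : Matrix (Fin m) (Fin m) ℝ}
    (hinv : (F 0).kkt⁻¹ = Matrix.fromBlocks G H Hᵀ (-S)) (i j : ι) :
    polarization F i j =
      -(1 / 2 : ℝ) * (G * F.d2Δ i j).trace + (1 / 2 : ℝ) * (G * F.dΔ i * G * F.dΔ j).trace - (H * F.d2Q i j).trace
        + (H * F.dQ i * H * F.dQ j).trace - (G * (F.dQ i)ᵀ * S * F.dQ j).trace + (G * F.dΔ i * H * F.dQ j).trace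
        + (G * F.dΔ j * H * F.dQ i).trace :=
  polarization_master F hQ hΔ (KKTBridge.kkt_det_ne_zero (F 0) hreg) hsymm hinv i j

/-- **(M) WITH THE EXPLICIT PROPAGATORS OF AN2-pv09 L3.2** — the full content of L3.2 + L3.3 as ONE kernel theorem:
for a background family with `C²` data, `(F 0).Regular`, `Δ(B)` symmetric near `0`, and ANY injective kernel
parametrisation `C : n × r` of `ker Q̃(0)` (`Q̃(0)C = 0`, `r + m = n`; one exists by pv23's
`KKTBridge.exists_kernelBasis`), the one-loop polarization is the master formula (M) with
`G = 𝒢 = C(CᵀΔ(0)C)⁻¹Cᵀ`, `H = ℋ = (1 − 𝒢Δ(0))Q̃(0)⁺`, `S = 𝒮 = (Q̃Q̃ᵀ)⁻¹Q̃(Δ − Δ𝒢Δ)Q̃⁺` (all at `B = 0`).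
Nonsingularity of `CᵀC`, `Q̃Q̃ᵀ`, `CᵀΔC` comes from pv23's `KKTBridge.gram_posDef`, `constraintGram_posDef`,
`reduced_posDef` (used by name). [folklore] -/
theorem polarization_master_explicit {r : ℕ} (F : Family ι n m)
    (hQ : ∀ a b, ContDiffAt ℝ 2 (fun B => (F B).Q a b) 0) (hΔ : ∀ a b, ContDiffAt ℝ 2 (fun B => (F B).Δ a b) 0)
    (hreg : (F 0).Regular) (hsymm : ∀ᶠ B in 𝓝 (0 : ι → ℝ), (F B).Δ.IsSymm)
    (C : Matrix (Fin n) (Fin r) ℝ) (hQC : (F 0).Q * C = 0) (hC : Function.Injective C.mulVec) (hr : r + m = n)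
    (i j : ι) :
    polarization F i j =
      -(1 / 2 : ℝ) * (cov (F 0).Δ C * F.d2Δ i j).trace
        + (1 / 2 : ℝ) * (cov (F 0).Δ C * F.dΔ i * cov (F 0).Δ C * F.dΔ j).trace
        - (minimiser (F 0).Δ (F 0).Q C * F.d2Q i j).trace
        + (minimiser (F 0).Δ (F 0).Q C * F.dQ i * minimiser (F 0).Δ (F 0).Q C * F.dQ j).trace
        - (cov (F 0).Δ C * (F.dQ i)ᵀ * schur (F 0).Δ (F 0).Q C * F.dQ j).trace
        + (cov (F 0).Δ C * F.dΔ i * minimiser (F 0).Δ (F 0).Q C * F.dQ j).trace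
        + (cov (F 0).Δ C * F.dΔ j * minimiser (F 0).Δ (F 0).Q C * F.dQ i).trace := by
  have hA : IsUnit (Cᵀ * C).det := isUnit_iff_ne_zero.2 (KKTBridge.gram_posDef C hC).det_pos.ne'
  have hM : IsUnit ((F 0).Q * (F 0).Qᵀ).det :=
    isUnit_iff_ne_zero.2 (KKTBridge.constraintGram_posDef (F 0).Q hreg.onto).det_pos.ne'
  have hΓ : IsUnit (Cᵀ * (F 0).Δ * C).det :=
    isUnit_iff_ne_zero.2 (KKTBridge.reduced_posDef (F 0) C hreg.symm hreg.posKer hQC hC).det_pos.ne'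
  have e : Fin n ≃ Fin r ⊕ Fin m := (finSumFinEquiv.trans (finCongr hr)).symm
  have hinv : (F 0).kkt⁻¹ = Matrix.fromBlocks (cov (F 0).Δ C) (minimiser (F 0).Δ (F 0).Q C)
      (minimiser (F 0).Δ (F 0).Q C)ᵀ (-schur (F 0).Δ (F 0).Q C) :=
    kkt_inv_eq_fromBlocks e (F 0).Δ (F 0).Q C hreg.symm hQC hA hM hΓ
  exact polarization_master F hQ hΔ (KKTBridge.kkt_det_ne_zero (F 0) hreg) hsymm hinv i j

end Family

end Literature.MathematicalPhysics.QuantumFieldTheory.Balaban1983to89.Beta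

end
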